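import Literature.MathematicalPhysics.QuantumLattice.LatticeGaugeDLRFreeEnergyProofs
import Literature.MathematicalPhysics.QuantumLattice.LatticeGaugeDLRGibbsProofs
import Literature.MathematicalPhysics.QuantumFieldTheory.Sweep1ShenZhuZhuProofs
import HarnessLib

/-!
# Boundary insensitivity of the Wilson kernel normaliser (energy programme, step E2)

Helper for crux `FibreToTorus` (stmt-QuantumFields-16244), line `Sketch`, energy programme
("differentiability of the pressure at `β` forces all translation-invariant DLR states to have the
same mean action density", Friedli–Velenik 2017, Prop. 6.91, for lattice gauge theory).  Step E2 is
the boundary-insensitivity estimate of the proof of Friedli–Velenik 2017, Thm. 3.6: the kernel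
normaliser `N(β, Λ, η) = ∫ exp(-β S_Λ(ζ η_{Λᶜ})) dζ` of the Wilson specification
(`S_Λ = wilsonBoundaryAction ρ Λ`, the sum over the plaquettes touching `Λ`) and the free partition
function `Z(β, A) = ∫ ∏_{p ∈ A} exp(-β (N - Re tr ρ(U_p))) dg_∞` of any set `A` of plaquettes touching
`Λ` whose edges all lie in `Λ` satisfy `|log N - log Z| ≤ |β| (N + M) · #(plaquettesTouching Λ \ A)`
(`M` a bound for `|Re tr ρ|`): the plaquettes outside `A` cost a factor `exp(±|β|(N + M))` each, and
the remaining fibre integral no longer feels the boundary condition, so that by the resampling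
identity for the infinite Haar product it equals `Z(β, A)`.
-/

noncomputable section

open MeasureTheory Filter Topology Finset
open Literature.Probability.LatticeModels (Site halfOpenBox glueWith)
open Literature.MathematicalPhysics.QuantumLattice (LGConfig ZdEdge ZdPlaquette plaquetteObs plaquetteEdges
  plaquettesTouching wilsonBoundaryAction ymSpecification ymGibbsMeasures IsZdTranslationInvariant
  freeEnergyDensity configShift)
open Literature.MathematicalPhysics.QuantumFieldTheory (haarProbability zdHaar)

namespace Summit.QuantumFields.YangMills.Theorems.FibreToTorus

/-- Logarithmic form of a two-sided multiplicative sandwich: if `e^{-c} b ≤ a ≤ e^{c} b` with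
`b > 0` then `|log a - log b| ≤ c`. [folklore] -/
private theorem abs_log_sub_log_le_of_sandwich {a b c : ℝ} (hb : 0 < b)
    (h1 : a ≤ Real.exp c * b) (h2 : Real.exp (-c) * b ≤ a) :
    |Real.log a - Real.log b| ≤ c := by
  have ha : 0 < a := lt_of_lt_of_le (mul_pos (Real.exp_pos _) hb) h2
  have h1' := Real.log_le_log ha h1
  have h2' := Real.log_le_log (mul_pos (Real.exp_pos _) hb) h2
  rw [Real.log_mul (Real.exp_pos _).ne' hb.ne', Real.log_exp] at h1' h2'
  rw [abs_le]
  constructor <;> linarith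

/-- **Boundary insensitivity of the kernel normaliser** (Friedli–Velenik 2017, proof of Thm. 3.6,
transcribed to the plaquette interaction): for `A ⊆ plaquettesTouching Λ` with all edges of the
plaquettes of `A` inside `Λ`,
`|log ∫ e^{-β S_Λ(ζ η_{Λᶜ})} dζ - log Z(β, A)| ≤ |β| (N + M) · #(plaquettesTouching Λ \ A)`.
The weight `e^{-β S_Λ}` is the product of the plaquette weights over `plaquettesTouching Λ`; those
outside `A` lie in `[e^{-|β|(N+M)}, e^{|β|(N+M)}]` (`FreeEnergy.boxWeight_le`,
`FreeEnergy.pow_le_boxWeight`), and the fibre integral of the weight of `A` does not depend on the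
boundary condition (the edges of `A` are resampled), hence equals `Z(β, A)` by the resampling
identity `integral_zdHaar_eq_integral_integral_glueWith`. [cite: FriedliVelenik2017, Ch. 3 §3.2.2, proof of Thm. 3.6 (boundary terms are a surface-order perturbation of the partition function)] -/
theorem energy_abs_logNormaliser_sub_logFree_le : ∀ (d N : ℕ) (G : Type) [Group G] [TopologicalSpace G] [IsTopologicalGroup G] [CompactSpace G] [MeasurableSpace G] [BorelSpace G] [SecondCountableTopology G] (ρ : G →* Matrix (Fin N) (Fin N) ℂ), Continuous ρ → ∀ (M : ℝ), (∀ g : G, |(ρ g).trace.re| ≤ M) → ∀ (Λ : Finset (ZdEdge d)) (A : Finset (ZdPlaquette d)), A ⊆ plaquettesTouching Λ → (∀ p ∈ A, plaquetteEdges p ⊆ Λ) → ∀ (η : LGConfig d G) (β : ℝ), |Real.log (∫ ζ, Real.exp (-β * wilsonBoundaryAction ρ Λ (glueWith Λ ζ η)) ∂(MeasureTheory.Measure.pi fun _ : ↥Λ => haarProbability G)) - Real.log (∫ U, ∏ p ∈ A, Real.exp (-β * ((N : ℝ) - plaquetteObs ρ p.1 p.2.1.1 p.2.1.2 U)) ∂(zdHaar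 d G))| ≤ |β| * (N + M) * #(plaquettesTouching Λ \ A) := by
  intro d N G _ _ _ _ _ _ _ ρ hρ M hM Λ A hA hAΛ η β
  -- the weight of `A`, the weight of the remaining plaquettes, the full kernel weight
  set W : LGConfig d G → ℝ := fun U =>
    ∏ p ∈ A, Real.exp (-β * ((N : ℝ) - plaquetteObs ρ p.1 p.2.1.1 p.2.1.2 U)) with hW
  set V : LGConfig d G → ℝ := fun U => ∏ p ∈ plaquettesTouching Λ \ A,
    Real.exp (-β * ((N : ℝ) - plaquetteObs ρ p.1 p.2.1.1 p.2.1.2 U)) with hV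
  set E : LGConfig d G → ℝ := fun U => Real.exp (-β * wilsonBoundaryAction ρ Λ U) with hE
  set π : Measure (↥Λ → G) := Measure.pi fun _ : ↥Λ => haarProbability G with hπ
  set K : ℝ := |β| * (N + M) with hK
  set r : ℕ := #(plaquettesTouching Λ \ A) with hr
  -- factorisation of the kernel weight
  have hsplit : ∀ U, E U = V U * W U := by
    intro U
    simp only [hE, hV, hW, wilsonBoundaryAction, Finset.mul_sum, Real.exp_sum]
    exact (Finset.prod_sdiff hA).symm
  -- bounds on the weight of the remaining plaquettes
  have hVup : ∀ U, V U ≤ Real.exp K ^ r := fun U =>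
    Literature.MathematicalPhysics.QuantumLattice.FreeEnergy.boxWeight_le ρ hM β _ U
  have hVlow : ∀ U, Real.exp (-K) ^ r ≤ V U := fun U =>
    Literature.MathematicalPhysics.QuantumLattice.FreeEnergy.pow_le_boxWeight ρ hM β _ U
  have hW0 : ∀ U, 0 ≤ W U := fun U => prod_nonneg fun p _ => (Real.exp_pos _).le
  -- continuity, integrability
  have hWc : Continuous W :=
    Literature.MathematicalPhysics.QuantumLattice.FreeEnergy.continuous_boxWeight ρ hρ β A
  have hEc : Continuous E :=
    Real.continuous_exp.comp (continuous_const.mul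
      (Literature.MathematicalPhysics.QuantumLattice.continuous_wilsonBoundaryAction ρ hρ Λ))
  have hglue : ∀ η' : LGConfig d G, Continuous fun ζ : ↥Λ → G => glueWith Λ ζ η' := fun η' =>
    (Literature.MathematicalPhysics.QuantumLattice.continuous_glueWith_prod Λ).comp
      (Continuous.prodMk_right η')
  obtain ⟨C, hC⟩ := Literature.MathematicalPhysics.QuantumLattice.exists_bound_of_continuous hWc
  obtain ⟨B, hB⟩ := Literature.MathematicalPhysics.QuantumLattice.exists_bound_of_continuous hEc
  have hWint : Integrable (fun ζ : ↥Λ → G => W (glueWith Λ ζ η)) π :=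
    Literature.MathematicalPhysics.QuantumLattice.integrable_of_bound
      (hWc.comp (hglue η)).aestronglyMeasurable fun ζ => hC _
  have hEint : Integrable (fun ζ : ↥Λ → G => E (glueWith Λ ζ η)) π :=
    Literature.MathematicalPhysics.QuantumLattice.integrable_of_bound
      (hEc.comp (hglue η)).aestronglyMeasurable fun ζ => hB _
  -- the sandwich for the normaliser
  have hup : (∫ ζ, E (glueWith Λ ζ η) ∂π) ≤ Real.exp K ^ r * ∫ ζ, W (glueWith Λ ζ η) ∂π := by
    rw [← integral_const_mul]
    refine integral_mono hEint (hWint.const_mul _) fun ζ => ?_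
    simp only [hsplit]
    exact mul_le_mul_of_nonneg_right (hVup _) (hW0 _)
  have hlow : Real.exp (-K) ^ r * (∫ ζ, W (glueWith Λ ζ η) ∂π) ≤ ∫ ζ, E (glueWith Λ ζ η) ∂π := by
    rw [← integral_const_mul]
    refine integral_mono (hWint.const_mul _) hEint fun ζ => ?_
    simp only [hsplit]
    exact mul_le_mul_of_nonneg_right (hVlow _) (hW0 _)
  -- the fibre integral of the weight of `A` does not feel the boundary condition ...
  have hfibre : ∀ (η' : LGConfig d G) (ζ : ↥Λ → G), W (glueWith Λ ζ η') = W (glueWith Λ ζ η) := by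
    intro η' ζ
    have hdep : DependsOn W ↑(A.biUnion plaquetteEdges) :=
      Literature.MathematicalPhysics.QuantumLattice.FreeEnergy.dependsOn_boxWeight ρ β A
    refine hdep fun e he => ?_
    obtain ⟨p, hp, hep⟩ := mem_biUnion.1 (mem_coe.1 he)
    have heΛ : e ∈ Λ := hAΛ p hp hep
    rw [Literature.Probability.LatticeModels.glueWith_apply_mem _ _ _ heΛ,
      Literature.Probability.LatticeModels.glueWith_apply_mem _ _ _ heΛ]
  -- ... hence is the free partition function (resampling identity for `dg_∞`)
  haveI : IsProbabilityMeasure (zdHaar d G) := by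
    unfold zdHaar; infer_instance
  have hIZ : (∫ U, W U ∂(zdHaar d G)) = ∫ ζ, W (glueWith Λ ζ η) ∂π := by
    rw [Literature.MathematicalPhysics.QuantumFieldTheory.integral_zdHaar_eq_integral_integral_glueWith
      Λ hWc.measurable hC]
    have hfun : (fun η' : LGConfig d G =>
        ∫ ζ, W (glueWith Λ ζ η') ∂(Measure.pi fun _ : ↥Λ => haarProbability G)) =
        fun _ => ∫ ζ, W (glueWith Λ ζ η) ∂π := by
      funext η'
      exact integral_congr_ae (ae_of_all _ fun ζ => hfibre η' ζ)
    rw [hfun, integral_const, probReal_univ, one_smul]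
  have hZ0 : 0 < ∫ U, W U ∂(zdHaar d G) :=
    Literature.MathematicalPhysics.QuantumLattice.FreeEnergy.zdZ_pos ρ hρ β A
  -- logarithms
  rw [hIZ] at hZ0
  have hmain := abs_log_sub_log_le_of_sandwich (a := ∫ ζ, E (glueWith Λ ζ η) ∂π) (c := r * K) hZ0
    (by rw [Real.exp_nat_mul]; exact hup) (by rw [neg_mul_eq_mul_neg, Real.exp_nat_mul]; exact hlow)
  calc |Real.log (∫ ζ, E (glueWith Λ ζ η) ∂π) - Real.log (∫ U, W U ∂(zdHaar d G))|
      = |Real.log (∫ ζ, E (glueWith Λ ζ η) ∂π) - Real.log (∫ ζ, W (glueWith Λ ζ η) ∂π)| := by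
        rw [hIZ]
    _ ≤ (r : ℝ) * K := hmain
    _ = K * r := mul_comm _ _
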